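import Literature.NumberTheory.LFunctions.RepulsiveLogFreeDensitySingleModulus
import HarnessLib

/-!
# Thorner–Zaman (Math. Z. 306 (2024)) Lemma 13 — PROOF file (sibling of the statement file)

Discharge of the named fact `Literature.NumberTheory.LFunctions.thornerZaman2024PNTAP_lemma13`
(typed in `RepulsiveLogFreeDensitySingleModulus.lean`, p452746, cell `landau-siegel` §C reader r3) as
`thornerZaman2024PNTAP_lemma13_holds : thornerZaman2024PNTAP_lemma13`, statement unchanged, no new
definitions and no new named facts (D-0014/D-0026: proof-only sibling file, kernel lane).

The lemma: if `(β₁,χ₁)` exists (`χ₁ ≠ 1` real, `1 − 1/(50 log q) ≤ β₁ < 1`, `L(β₁,χ₁) = 0`),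
`q ≥ 2`, `(a,q) = 1`, `4 ≤ h ≤ x`, `x^{1/2} ≤ h`, then the Siegel correction
`λ = λ(x,q,a,h) = (1/h)∫_{x−h}^x (1 − χ₁(a)t^{β₁−1}) dt` of the uniform prime number theorem for
arithmetic progressions satisfies `(1/8) min{1,(1−β₁) log x} < λ < 2` [ThornerZaman2024PNTAP,
(1.7) and Lemma 13 p.10].

Source read on the held copy `paper:arxiv-2108.10878` p.10 (Lemma 13 and its proof, L5–L42).

«The programme SEARCHES and TYPES; no claim about Landau–Siegel zeros, Theorems 1–2 of
arXiv:2211.02515 or a repaired Margin232 until a kernel theorem says so.»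

## References

* [ThornerZaman2024PNTAP] J. Thorner, A. Zaman, *Refinements to the prime number theorem for
  arithmetic progressions*, Math. Z. **306** (2024), doi:10.1007/s00209-023-03414-3 =
  arXiv:2108.10878 — Lemma 13 = (1.7), proof p.10.
-/

noncomputable section

namespace Literature.NumberTheory.LFunctions

open ThornerZaman2024PNTAP

/-! ### Lemma 13 PROVED (discharge of the named fact `thornerZaman2024PNTAP_lemma13`)

The printed proof [ThornerZaman2024PNTAP, proof of Lemma 13 p.10] writes `λ = 1 − χ₁(a)ξ^{β₁−1}`
for a mean-value point `ξ ∈ (x−h,x)` with `x/3 < ξ < x`, and then treats the cases `χ₁(a) = −1`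
(trivially `λ > 1`), `χ₁(a) = 1` (Taylor expansion of `t/(1 − e^{−t})`). We follow the same case
split but replace the mean-value step by the closed form
`∫_{x−h}^x t^{β₁−1} dt = (x^{β₁} − (x−h)^{β₁})/β₁` and the chord bound
`x^{β₁} − (x−h)^{β₁} ≤ h·x^{β₁−1}` (concavity), which gives `1 − x^{β₁−1}/β₁ ≤ λ ≤ 1 + x^{β₁−1}/β₁`;
the printed numerical conclusion then follows from `e^{−u} ≤ 1/(1+u)` (i.e. `1 + u ≤ e^u`), `log 4 > 1.38`,
`1 − β₁ ≤ 1/(50 log 2) < 3/100` and `e^{−1} < 0.3679`. (The hypothesis `x^{1/2} ≤ h` of the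
printed lemma is not needed on this road; it is of course kept in the statement.) -/

namespace ThornerZaman2024PNTAP

/-- Closed form of the Siegel-correction integral: `∫_{x−h}^x t^{β−1} dt = (x^β − (x−h)^β)/β`
for `β > 0`. [cite: ThornerZaman2024PNTAP, (1.4) and the definition of λ in Theorem 1 p.3] -/
theorem integral_rpow_sub_one {β : ℝ} (hβ : 0 < β) (x h : ℝ) :
    ∫ t in (x - h)..x, t ^ (β - 1) = (x ^ β - (x - h) ^ β) / β := by
  have hr : -1 < β - 1 := by linarith
  rw [integral_rpow (Or.inl hr), sub_add_cancel]

/-- `λ = 1 − χ₁(a)·(x^{β₁} − (x−h)^{β₁})/(β₁h)` (the source's (1.4): "`λh/φ(q)` equals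
`h/φ(q) − χ₁(a)(x^{β₁} − (x−h)^{β₁})/(β₁φ(q))`"). [cite: ThornerZaman2024PNTAP, (1.4) p.3] -/
theorem lambdaExc_eq {q : ℕ} [NeZero q] (χ₁ : DirichletCharacter ℂ q) {β₁ : ℝ} (hβ : 0 < β₁)
    (a : ZMod q) (x : ℝ) {h : ℝ} (hh : h ≠ 0) :
    lambdaExc χ₁ β₁ a x h = 1 - (χ₁ a).re * ((x ^ β₁ - (x - h) ^ β₁) / (β₁ * h)) := by
  unfold lambdaExc
  have hint : IntervalIntegrable (fun t : ℝ => (χ₁ a).re * t ^ (β₁ - 1))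
      MeasureTheory.volume (x - h) x :=
    (intervalIntegral.intervalIntegrable_rpow' (by linarith)).const_mul _
  have hsplit : (∫ t in (x - h)..x, (1 - (χ₁ a).re * t ^ (β₁ - 1))) =
      (∫ _ in (x - h)..x, (1 : ℝ)) - ∫ t in (x - h)..x, (χ₁ a).re * t ^ (β₁ - 1) :=
    intervalIntegral.integral_sub intervalIntegrable_const hint
  rw [hsplit, intervalIntegral.integral_const, intervalIntegral.integral_const_mul,
    integral_rpow_sub_one hβ]
  simp only [smul_eq_mul, mul_one]
  field_simp
  ring

/-- `0 ≤ x^β − (x−h)^β` for `0 ≤ x − h`, `0 ≤ h`, `β ≥ 0` (monotonicity of `t ↦ t^β`).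
[cite: ThornerZaman2024PNTAP, proof of Lemma 13 p.10] -/
theorem corr_nonneg {β x h : ℝ} (hβ : 0 ≤ β) (hxh : 0 ≤ x - h) (hh : 0 ≤ h) :
    0 ≤ x ^ β - (x - h) ^ β := by
  have : (x - h) ^ β ≤ x ^ β := Real.rpow_le_rpow hxh (by linarith) hβ
  linarith

/-- The chord bound `x^β − (x−h)^β ≤ h·x^{β−1}` for `0 < β ≤ 1`, `0 ≤ x − h`, `0 < h`
(concavity of `t ↦ t^β`; replaces the source's mean-value point `ξ`).
[cite: ThornerZaman2024PNTAP, proof of Lemma 13 p.10] -/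
theorem corr_le {β x h : ℝ} (hβ0 : 0 < β) (hβ1 : β ≤ 1) (hxh : 0 ≤ x - h) (hh : 0 < h) :
    x ^ β - (x - h) ^ β ≤ h * x ^ (β - 1) := by
  have hx : 0 < x := by linarith
  have hxβ : x ^ β = x ^ (β - 1) * x := by
    rw [← Real.rpow_add_one hx.ne' (β - 1), sub_add_cancel]
  rcases hxh.eq_or_lt with h0 | hpos
  · have hhx : h = x := by linarith
    rw [← h0, Real.zero_rpow hβ0.ne', hhx, hxβ]
    linarith
  · have hmono : x ^ (β - 1) ≤ (x - h) ^ (β - 1) :=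
      Real.rpow_le_rpow_of_nonpos hpos (by linarith) (by linarith)
    have hxhβ : (x - h) ^ β = (x - h) ^ (β - 1) * (x - h) := by
      rw [← Real.rpow_add_one hpos.ne' (β - 1), sub_add_cancel]
    have hprod : x ^ (β - 1) * (x - h) ≤ (x - h) ^ (β - 1) * (x - h) :=
      mul_le_mul_of_nonneg_right hmono hpos.le
    rw [hxβ, hxhβ]
    nlinarith [hprod]

/-- The polynomial inequality behind the case `χ₁(a) = 1`, `u = (1−β₁) log x ≤ 1/6`:
with `δ = 1 − β₁ > 0`, `L = log x ≥ 1.38`, `δL ≤ 1/6` one has `1 < (1 − δL/8)(1 − δ)(1 + δL)`.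
[cite: ThornerZaman2024PNTAP, proof of Lemma 13 p.10] -/
theorem key_small {δ L : ℝ} (hδ : 0 < δ) (hL : 1.38 ≤ L) (h6 : δ * L ≤ 1 / 6) :
    1 < (1 - 1 / 8 * (δ * L)) * (1 - δ) * (1 + δ * L) := by
  have hL0 : 0 < L := by linarith
  have p1 : 0 ≤ δ * L * (1 / 6 - δ * L) := mul_nonneg (mul_pos hδ hL0).le (by linarith)
  have p2 : 0 ≤ δ * (1 / 6 - δ * L) := mul_nonneg hδ.le (by linarith)
  have p3 : 0 ≤ δ * (L - 1.38) := mul_nonneg hδ.le (by linarith)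
  have p4 : 0 ≤ δ * (δ * L) * (δ * L) := by positivity
  nlinarith [p1, p2, p3, p4, hδ]

/-- The polynomial inequality behind the case `χ₁(a) = 1`, `1/6 < u < 1`: with `0 < δ ≤ 3/100`
one has `1 < (1 − u/8)(1 − δ)(1 + u)`. [cite: ThornerZaman2024PNTAP, proof of Lemma 13 p.10] -/
theorem key_large {δ u : ℝ} (hδ : 0 < δ) (hδ3 : δ ≤ 3 / 100) (hu6 : 1 / 6 < u) (hu1 : u < 1) :
    1 < (1 - 1 / 8 * u) * (1 - δ) * (1 + u) := by
  have hu0 : 0 < u := by linarith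
  have p1 : 0 ≤ u * (1 - u) := mul_nonneg hu0.le (by linarith)
  have p2 : 0 ≤ (3 / 100 - δ) * u := mul_nonneg (by linarith) hu0.le
  have p3 : 0 ≤ u * u * δ := by positivity
  nlinarith [p1, p2, p3, hδ]

/-- The numerical heart of Lemma 13: for `x ≥ 4` and `0 < 1 − β ≤ 3/100`,
`x^{β−1}/β < 1 − (1/8)·min{1,(1−β) log x}`. [cite: ThornerZaman2024PNTAP, proof of Lemma 13 p.10] -/
theorem rpow_div_lt_one_sub_nu {β x : ℝ} (hx : 4 ≤ x) (hβ1 : β < 1) (hδ : 1 - β ≤ 3 / 100) :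
    x ^ (β - 1) / β < 1 - 1 / 8 * nu β x := by
  have hxpos : 0 < x := by linarith
  have hβpos : 0 < β := by linarith
  have hlog4 : (1.38 : ℝ) < Real.log 4 := by
    have h4 : Real.log 4 = 2 * Real.log 2 := by
      rw [show (4 : ℝ) = 2 ^ 2 by norm_num, Real.log_pow]
      norm_num
    rw [h4]
    linarith [Real.log_two_gt_d9]
  have hL : Real.log 4 ≤ Real.log x := Real.log_le_log (by norm_num) hx
  have hLpos : 0 < Real.log x := by linarith
  have hδpos : 0 < 1 - β := by linarith
  have hupos : 0 < (1 - β) * Real.log x := mul_pos hδpos hLpos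
  have hrpow : x ^ (β - 1) = Real.exp (-((1 - β) * Real.log x)) := by
    rw [Real.rpow_def_of_pos hxpos]
    congr 1
    ring
  unfold nu
  rw [hrpow]
  rcases le_or_gt 1 ((1 - β) * Real.log x) with hu1 | hu1
  · -- `u ≥ 1`: `e^{−u} ≤ e^{−1} < 0.3679 < (7/8)β`
    rw [min_eq_left hu1, div_lt_iff₀ hβpos]
    have he : Real.exp (-((1 - β) * Real.log x)) ≤ Real.exp (-1) :=
      Real.exp_le_exp.2 (by linarith)
    have he1 : Real.exp (-1) < 0.3678794412 := Real.exp_neg_one_lt_d9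
    nlinarith
  · -- `u < 1`: `e^{−u} ≤ 1/(1+u) < β(1 − u/8)`
    rw [min_eq_right hu1.le, div_lt_iff₀ hβpos]
    -- `e^{−u} ≤ 1/(1+u)` (from `1 + u ≤ e^u`; the tree's
    -- `Literature.Probability.LatticeModels.SixVertex.exp_neg_le_one_div_add` is the same
    -- inequality in an unrelated module — re-derived inline rather than imported)
    have hexp : Real.exp (-((1 - β) * Real.log x)) ≤ 1 / (1 + (1 - β) * Real.log x) := by
      have h1 : 1 + (1 - β) * Real.log x ≤ Real.exp ((1 - β) * Real.log x) := by
        linarith [Real.add_one_le_exp ((1 - β) * Real.log x)]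
      rw [Real.exp_neg, one_div]
      exact inv_anti₀ (by linarith) h1
    have key : 1 < (1 - 1 / 8 * ((1 - β) * Real.log x)) * β * (1 + (1 - β) * Real.log x) := by
      rcases le_or_gt ((1 - β) * Real.log x) (1 / 6) with hu6 | hu6
      · have := key_small hδpos (le_trans hlog4.le hL) hu6
        simpa only [sub_sub_cancel] using this
      · have := key_large hδpos hδ hu6 hu1
        simpa only [sub_sub_cancel] using this
    calc Real.exp (-((1 - β) * Real.log x)) ≤ 1 / (1 + (1 - β) * Real.log x) := hexp
      _ < (1 - 1 / 8 * ((1 - β) * Real.log x)) * β := by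
          rw [div_lt_iff₀ (by linarith : (0 : ℝ) < 1 + (1 - β) * Real.log x)]
          linarith [key]

end ThornerZaman2024PNTAP

/-- **Thorner–Zaman (Math. Z. 2024), Lemma 13 = (1.7) — PROVED** (discharge of the named fact
`thornerZaman2024PNTAP_lemma13`, statement unchanged): if `(β₁,χ₁)` exists, `(a,q) = 1`,
`4 ≤ h ≤ x` and `x^{1/2} ≤ h`, then `(1/8) min{1,(1−β₁) log x} < λ(x,q,a,h) < 2`. Proof: `χ₁`
is real, so `χ₁(a) ∈ {0, 1, −1}`; `λ = 1 − χ₁(a)·J` with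
`0 ≤ J = (x^{β₁} − (x−h)^{β₁})/(β₁h) ≤ x^{β₁−1}/β₁ < 1 − (1/8)ν(x)` (the last by
`rpow_div_lt_one_sub_nu`, using `1 − β₁ ≤ 1/(50 log q) ≤ 1/(50 log 2) < 3/100` for `q ≥ 2`).
[cite: ThornerZaman2024PNTAP, Lemma 13 and its proof p.10] -/
theorem thornerZaman2024PNTAP_lemma13_holds : thornerZaman2024PNTAP_lemma13 := by
  unfold thornerZaman2024PNTAP_lemma13
  intro q _ hq χ₁ β₁ hE a _ x h h4 _ hhx
  have hE' : χ₁ ≠ 1 ∧ χ₁.IsQuadratic ∧ 1 - 1 / (50 * Real.log q) ≤ β₁ ∧ β₁ < 1 ∧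
      χ₁.LFunction β₁ = 0 := hE
  obtain ⟨_, hquad, hβlo, hβ1, _⟩ := hE'
  -- `1 − β₁ ≤ 1/(50 log q) ≤ 1/(50 log 2) < 3/100`
  have hlogq : Real.log 2 ≤ Real.log q :=
    Real.log_le_log two_pos (by exact_mod_cast hq)
  have hlog2 : (0.6931471803 : ℝ) < Real.log 2 := Real.log_two_gt_d9
  have hlogq_pos : 0 < 50 * Real.log q := by linarith
  have hδ : 1 - β₁ ≤ 3 / 100 := by
    have h50 : 1 / (50 * Real.log q) ≤ 3 / 100 := by
      rw [div_le_iff₀ hlogq_pos]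
      nlinarith
    linarith
  have hβpos : 0 < β₁ := by linarith
  have hh : 0 < h := by linarith
  have hx4 : 4 ≤ x := le_trans h4 hhx
  have hxh : 0 ≤ x - h := by linarith
  -- the correction ratio `J`
  have hJ0 : 0 ≤ (x ^ β₁ - (x - h) ^ β₁) / (β₁ * h) :=
    div_nonneg (ThornerZaman2024PNTAP.corr_nonneg hβpos.le hxh hh.le) (mul_pos hβpos hh).le
  have hJle : (x ^ β₁ - (x - h) ^ β₁) / (β₁ * h) ≤ x ^ (β₁ - 1) / β₁ := by
    rw [div_le_div_iff₀ (mul_pos hβpos hh) hβpos]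
    have hc := ThornerZaman2024PNTAP.corr_le hβpos hβ1.le hxh hh
    have hxpow : 0 ≤ x ^ (β₁ - 1) := Real.rpow_nonneg (by linarith) _
    nlinarith [mul_le_mul_of_nonneg_right hc hβpos.le]
  have hN := ThornerZaman2024PNTAP.rpow_div_lt_one_sub_nu hx4 hβ1 hδ
  have hnu1 : nu β₁ x ≤ 1 := ThornerZaman2024PNTAP.nu_le_one _ _
  have hnu0 : 0 ≤ nu β₁ x := ThornerZaman2024PNTAP.nu_nonneg hβ1.le (by linarith)
  have hlam := ThornerZaman2024PNTAP.lambdaExc_eq χ₁ hβpos a x hh.ne'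
  rcases hquad a with h0 | h1 | hm1
  · -- `χ₁(a) = 0` (cannot happen for `(a,q) = 1`, but then `λ = 1` anyway)
    rw [hlam, h0, Complex.zero_re, zero_mul, sub_zero]
    constructor <;> linarith
  · -- `χ₁(a) = 1`: `λ = 1 − J ≥ 1 − x^{β₁−1}/β₁ > ν(x)/8`, and `λ ≤ 1 < 2`
    rw [hlam, h1, Complex.one_re, one_mul]
    constructor <;> linarith
  · -- `χ₁(a) = −1`: `λ = 1 + J ≥ 1 > ν(x)/8`, and `λ ≤ 1 + x^{β₁−1}/β₁ < 2`
    rw [hlam, hm1, Complex.neg_re, Complex.one_re, neg_mul, one_mul, sub_neg_eq_add]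
    constructor <;> linarith

end Literature.NumberTheory.LFunctions
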